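import Literature.Probability.Percolation.TriTileDomain
import HarnessLib

/-!
# The boundary traversal of a union of tiles: runs of darts at a site, tail steps, boundary edges

Topic `Literature/Probability/Percolation`; family `crit-perc`. Combinatorics of the anticlockwise
boundary traversal (`triBdryIter`, `TriDiscreteDomain.lean`) of a marked discrete domain whose
site set is a union of tiles (`tileUnion`, `TriCoarseTiling.lean` — the tree's form of
Bollobás–Riordan's "hexagon of hexagons", *Percolation* (2006), Ch. 7 p. 195), as needed to read
the boundary of the approximating domains of Lemma 14 (p. 184) as a closed lattice polyline
through the *tails* of the boundary darts ("Let us trace the boundary of `G_δ⁻` anticlockwise.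
Each boundary vertex `v` …", p. 191):

* `three_le_card_filter_add_triDir_mem_tileUnion` — every site of a union of tiles has at least
  three lattice neighbours in it (three in its own tile: a check over the `19` residues);
  `exists_removableAt_of_mem_tileUnion` — hence a boundary site `u` of a union of tiles is
  *removable* (`RemovableAt`, `TriDiscShelling.lean`): its outside neighbours are those in `m`
  consecutive directions `a, …, a + m - 1`, with `m ≤ 3`.
* `RemovableAt.exists_run` — **the darts out of `u` form one run of the traversal**: there is a
  position `n₀` such that positions `n₀, …, n₀ + m - 1` carry the darts
  `u → u + e_{a}, …, u → u + e_{a+m-1}`, position `n₀ - 1` carries `dMinus` (tail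
  `u + e_{a+5}`, the last inside neighbour) and position `n₀ + m` carries `dPlus` (tail
  `u + e_{a+m}`, the first inside neighbour); a position with tail `u` lies in the run
  (`RemovableAt.exists_eq_of_fst_iter_eq`).
* **Tail steps** (`tail n ≠ tail (n + 1)`): at such a step the new tail's run is entered, so the
  old tail is the new tail's last inside neighbour, and the old tail's run is left, so the new tail
  is the old tail's first inside neighbour (`RemovableAt.eq_of_tailStep_in`,
  `RemovableAt.eq_of_tailStep_out`); consequently **no boundary edge is traversed twice**
  (`tailStep_pair_eq`: equal unordered pairs of consecutive distinct tails occur only at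
  congruent positions, given outside blocks of size `≤ 4` at both ends); `bdryTail G b n` is
  the tail at position `n`, `RemovableAt.tailStep_neighbours` lists the two boundary edges at a site.

## References

* B. Bollobás, O. Riordan, *Percolation*, Cambridge University Press (2006), Ch. 7 §7.2.2 p. 168
  ("Following this cycle in an anticlockwise direction"), §7.2.5 p. 191, p. 195.

## Mathlib / tree

Mathlib: `decide`, `Finset.card`. Tree: `TriDiscShelling.lean` (`RemovableAt`, `blk`, `dMinus`,
`dPlus`, `iter_block`, `iter_dMinus`, `iter_fst_ne`, `IsTriDisc.iter_eq_iter_iff`, `iter_mod`,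
`triBdryIter_add`), `TriCoarseTiling.lean` (`tileOff`, `tileCentre_add_triDir`, `mem_tileUnion_iff`),
`TriTileDomain.lean` (`oneBlockAt_tileUnion`), `TriOneBlock.lean` (`OneBlockAt`).
-/

noncomputable section

open Finset Literature.Probability.LatticeModels

namespace Literature.Probability.Percolation

/-! ### Sites of a union of tiles have three neighbours in it -/

/-- **Three of the six neighbours of any site lie in its own tile** (a check over the `19`
residues). [folklore] -/
theorem three_le_card_tileOff_eq_zero (k : ZMod 19) : 3 ≤ #(univ.filter fun j : Fin 6 => tileOff k j = 0) := by
  revert k; decide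

/-- **Every site of a union of tiles has at least three lattice neighbours in the union.** [folklore] -/
theorem three_le_card_filter_add_triDir_mem_tileUnion {S' : Finset (Site 2)} {x : Site 2} (hx : x ∈ tileUnion S') :
    3 ≤ #(univ.filter fun j : Fin 6 => x + triDir j ∈ tileUnion S') := by
  refine (three_le_card_tileOff_eq_zero (tilePhi x)).trans (card_le_card fun j hj => ?_)
  rw [mem_filter] at hj ⊢
  refine ⟨mem_univ _, ?_⟩
  rw [mem_tileUnion_iff] at hx ⊢
  rw [tileCentre_add_triDir, hj.2, add_zero]
  exact hx

/-- The value of `a + t` for `Fin 6` offsets below the wrap-around. [folklore] -/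
theorem Fin6.val_add_of_lt {m t : Fin 6} (h : m.val + t.val < 6) : (m + t).val = m.val + t.val := by
  rw [Fin.val_add, Nat.mod_eq_of_lt h]

/-- The value of `a + t` for `Fin 6` offsets beyond the wrap-around. [folklore] -/
theorem Fin6.val_add_of_le {m t : Fin 6} (h : 6 ≤ m.val + t.val) : (m + t).val = m.val + t.val - 6 := by
  rw [Fin.val_add]
  have h1 : m.val + t.val < 12 := by omega
  omega

/-- **A boundary site of a union of tiles is removable with an outside block of size at most
three**: its outside neighbours are those in the `m ≤ 3` consecutive directions `a, …, a + m - 1`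
(one block by `oneBlockAt_tileUnion`, of size `6 - #{inside} ≤ 3`). [folklore] -/
theorem exists_removableAt_of_mem_tileUnion {S' : Finset (Site 2)} {u : Site 2} (hu : u ∈ tileUnion S')
    (hout : ∃ j : Fin 6, u + triDir j ∉ tileUnion S') :
    ∃ a m : Fin 6, RemovableAt (tileUnion S') u a m ∧ m.val ≤ 3 := by
  have h3 := three_le_card_filter_add_triDir_mem_tileUnion hu
  rcases oneBlockAt_tileUnion S' u with hall | hnone | ⟨a, m, hm1, hblk⟩
  · obtain ⟨j, hj⟩ := hout; exact absurd (hall j) hj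
  · have : #(univ.filter fun j : Fin 6 => u + triDir j ∈ tileUnion S') = 0 := by
      rw [card_eq_zero, filter_eq_empty_iff]; exact fun j _ => hnone j
    omega
  · -- the inside block is `a, …, a + m - 1`; the outside block starts at `a + m`, of size `6 - m`
    have hm6 : m.val < 6 := m.isLt
    have hm5 : m.val ≤ 5 := by omega
    -- `m ≥ 3`: the inside directions are `a + t`, `t < m`
    have hcard : #(univ.filter fun j : Fin 6 => u + triDir j ∈ tileUnion S') = m.val := by
      have e : (univ.filter fun j : Fin 6 => u + triDir j ∈ tileUnion S') =
          (univ.filter fun t : Fin 6 => t.val < m.val).image fun t => a + t := by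
        ext j
        simp only [mem_filter, mem_univ, true_and, mem_image]
        constructor
        · intro hj
          refine ⟨j - a, (hblk (j - a)).1 (by rwa [add_sub_cancel]), by abel⟩
        · rintro ⟨t, ht, rfl⟩; exact (hblk t).2 ht
      rw [e, card_image_of_injective _ (add_right_injective a)]
      have key : ∀ m : Fin 6, #(univ.filter fun t : Fin 6 => t.val < m.val) = m.val := by decide
      exact key m
    have hm3 : 3 ≤ m.val := by omega
    refine ⟨a + m, ⟨6 - m.val, by omega⟩, ⟨hu, by simp only; omega, fun t => ?_⟩, by simp only; omega⟩
    -- `u + triDir (a + m + t) ∉ G ↔ t < 6 - m`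
    rw [add_assoc, hblk (m + t)]
    simp only
    constructor
    · intro h
      by_contra ht
      push Not at ht
      apply h
      rw [Fin6.val_add_of_le (by omega)]
      omega
    · intro ht h
      rw [Fin6.val_add_of_lt (by omega)] at h
      omega

/-! ### The run of darts out of a removable site -/

namespace RemovableAt

variable {G : Finset (Site 2)} {b : Site 2 × Site 2} {u : Site 2} {a m : Fin 6}

/-- **The darts out of `u` form one run of the traversal.** For a disc `G` traversed from `b` and a
removable site `u` (outside block `a, …, a + m - 1`) there is a position `n₀ < #∂G` with: positions
`n₀ + s` (`s < m`) carry the block darts `u → u + e_{a+s}`; position `n₀ + m` carries `dPlus`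
(tail the first inside neighbour `u + e_{a+m}`); position `n₀ + #∂G - 1` (i.e. `n₀ - 1`) carries
`dMinus` (tail the last inside neighbour `u + e_{a+5}`). [folklore] -/
theorem exists_run (h : RemovableAt G u a m) (hD : IsTriDisc G b) :
    ∃ n₀ < #(triBdryDarts G),
      (∀ s : ℕ, ∀ hs : s < m.val, triBdryIter G b (n₀ + s) = blk u a ⟨s, by have := m.isLt; omega⟩) ∧
      triBdryIter G b (n₀ + m.val) = dPlus u a m ∧
      triBdryIter G b (n₀ + (#(triBdryDarts G) - 1)) = dMinus u a := by
  set N := #(triBdryDarts G) with hN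
  obtain ⟨p, hp, hpeq⟩ := hD.cycle _ h.dPlus_mem
  obtain ⟨hmN, hdm⟩ := h.iter_dMinus hD
  -- traversal from `dPlus` is the traversal from `b` shifted by `p`
  have hshift : ∀ j, triBdryIter G (dPlus u a m) j = triBdryIter G b (p + j) := fun j => by
    rw [triBdryIter_add, hpeq]
  refine ⟨(p + (N - m.val)) % N, Nat.mod_lt _ hD.card_pos, fun s hs => ?_, ?_, ?_⟩
  · obtain ⟨-, hit⟩ := h.iter_block hD (m.val - 1 - s) (by omega)
    have e : (⟨m.val - 1 - (m.val - 1 - s), by omega⟩ : Fin 6) = ⟨s, by have := m.isLt; omega⟩ :=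
      Fin.ext (by simp; omega)
    rw [e, hshift] at hit
    rw [← hit, hD.iter_eq_iter_iff, Nat.add_mod, Nat.mod_mod, ← Nat.add_mod]
    congr 1; omega
  · rw [← hD.iter_mod, Nat.add_mod, Nat.mod_mod, ← Nat.add_mod]
    have e : (p + (N - m.val) + m.val) = p + N := by omega
    rw [e, hD.iter_mod, hD.iter_add_card, hpeq]
  · rw [hshift] at hdm
    rw [← hdm, hD.iter_eq_iter_iff, Nat.add_mod, Nat.mod_mod, ← Nat.add_mod]
    have e : p + (N - m.val) + (N - 1) = (p + (N - m.val - 1)) + N := by omega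
    rw [e, Nat.add_mod_right]

/-- **Off its run the tail is not `u`**: if position `n` has tail `u` then `n ≡ n₀ + s` for some
`s < m` (with `n₀` the start of the run of `exists_run`). [folklore] -/
theorem exists_eq_of_fst_iter_eq (h : RemovableAt G u a m) (hD : IsTriDisc G b) {n₀ : ℕ}
    (hrun : ∀ s : ℕ, ∀ hs : s < m.val, triBdryIter G b (n₀ + s) = blk u a ⟨s, by have := m.isLt; omega⟩)
    {n : ℕ} (hn : (triBdryIter G b n).1 = u) :
    ∃ s < m.val, n % #(triBdryDarts G) = (n₀ + s) % #(triBdryDarts G) := by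
  set d := triBdryIter G b n with hd
  obtain ⟨-, hy, hadj⟩ := mem_triBdryDarts.1 (triBdryIter_mem hD.base_mem n : d ∈ triBdryDarts G)
  obtain ⟨j, hj⟩ := (triGraph_adj_iff_triDir d.1 d.2).1 hadj
  obtain ⟨t, rfl⟩ := exists_offset a j
  rw [hn] at hj
  have ht : t.val < m.val := (h.out_iff t).1 (hj ▸ hy)
  refine ⟨t.val, ht, ?_⟩
  have hdeq : d = blk u a t := Prod.ext hn hj
  have := hrun t.val ht
  rw [show (⟨t.val, _⟩ : Fin 6) = t from Fin.ext rfl] at this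
  rw [← this, hd, hD.iter_eq_iter_iff] at hdeq
  exact hdeq

end RemovableAt

/-! ### Tail steps -/

section TailSteps

variable {G : Finset (Site 2)} {b : Site 2 × Site 2}

/-- The tail at position `n` of the traversal. [folklore] -/
def bdryTail (G : Finset (Site 2)) (b : Site 2 × Site 2) (n : ℕ) : Site 2 := (triBdryIter G b n).1

/-- The tail is periodic. [folklore] -/
theorem bdryTail_add_card (hD : IsTriDisc G b) (n : ℕ) : bdryTail G b (n + #(triBdryDarts G)) = bdryTail G b n := by
  rw [bdryTail, bdryTail, hD.iter_add_card]

/-- The tail only depends on the position modulo the period. [folklore] -/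
theorem bdryTail_mod (hD : IsTriDisc G b) (n : ℕ) : bdryTail G b (n % #(triBdryDarts G)) = bdryTail G b n := by
  rw [bdryTail, bdryTail, hD.iter_mod]

/-- Tails are sites of `G`. [folklore] -/
theorem bdryTail_mem (hD : IsTriDisc G b) (n : ℕ) : bdryTail G b n ∈ G :=
  (mem_triBdryDarts.1 (triBdryIter_mem hD.base_mem n)).1

/-- **Consecutive tails are equal or adjacent** (the successor keeps the tail or moves it to the
apex of the left face, a neighbour). [folklore] -/
theorem bdryTail_succ_eq_or_adj (hD : IsTriDisc G b) (n : ℕ) :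
    bdryTail G b (n + 1) = bdryTail G b n ∨ triGraph.Adj (bdryTail G b n) (bdryTail G b (n + 1)) := by
  rw [bdryTail, bdryTail, triBdryIter_succ, triBdrySucc]
  obtain ⟨-, -, hadj⟩ := mem_triBdryDarts.1 (triBdryIter_mem hD.base_mem n)
  split_ifs with hap
  · exact Or.inr (triGraph_adj_triLeftApex_left hadj)
  · exact Or.inl rfl

/-- **Entering a run.** If the tail changes at the step `n → n + 1` and the new tail `u` is
removable (outside block `a, …, a + m - 1`, run starting at `n₀`), then `n + 1 ≡ n₀` and the old
tail is the last inside neighbour `u + e_{a+5}`. [folklore] -/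
theorem RemovableAt.eq_of_tailStep_in {u : Site 2} {a m : Fin 6} (h : RemovableAt G u a m) (hD : IsTriDisc G b)
    {n₀ : ℕ} (hrun : ∀ s : ℕ, ∀ hs : s < m.val, triBdryIter G b (n₀ + s) = RemovableAt.blk u a ⟨s, by have := m.isLt; omega⟩)
    (hdm : triBdryIter G b (n₀ + (#(triBdryDarts G) - 1)) = RemovableAt.dMinus u a)
    {n : ℕ} (hne : bdryTail G b n ≠ bdryTail G b (n + 1)) (hu : bdryTail G b (n + 1) = u) :
    (n + 1) % #(triBdryDarts G) = n₀ % #(triBdryDarts G) ∧ bdryTail G b n = u + triDir (a + 5) := by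
  set N := #(triBdryDarts G) with hN
  have hN0 := hD.card_pos
  obtain ⟨s, hs, hmod⟩ := h.exists_eq_of_fst_iter_eq hD hrun hu
  -- `s = 0`: otherwise position `n` is in the run too and the tail does not change
  have hs0 : s = 0 := by
    by_contra hs0
    have hprev : n % N = (n₀ + (s - 1)) % N := by
      have e1 : (n + 1) % N = ((n₀ + (s - 1)) + 1) % N := by rw [hmod]; congr 1; omega
      -- cancel the `+ 1` modulo `N`
      have := Nat.ModEq.add_right_cancel' 1 (e1 : Nat.ModEq N (n + 1) (n₀ + (s - 1) + 1))
      exact this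
    have h1 : bdryTail G b n = u := by
      rw [← bdryTail_mod hD, hprev, bdryTail_mod hD, bdryTail, hrun (s - 1) (by omega)]; rfl
    exact hne (h1.trans hu.symm)
  subst hs0
  rw [add_zero] at hmod
  refine ⟨hmod, ?_⟩
  -- position `n ≡ n₀ - 1` carries `dMinus`
  have hprev : n % N = (n₀ + (N - 1)) % N := by
    have e1 : (n + 1) % N = ((n₀ + (N - 1)) + 1) % N := by
      rw [hmod, show n₀ + (N - 1) + 1 = n₀ + N by omega, Nat.add_mod_right]
    exact Nat.ModEq.add_right_cancel' 1 (e1 : Nat.ModEq N (n + 1) (n₀ + (N - 1) + 1))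
  rw [← bdryTail_mod hD, hprev, bdryTail_mod hD, bdryTail, hdm, RemovableAt.dMinus]

/-- **Leaving a run.** If the tail changes at the step `n → n + 1` and the old tail `u` is removable
(outside block `a, …, a + m - 1`, run starting at `n₀`), then `n ≡ n₀ + m - 1` and the new tail is
the first inside neighbour `u + e_{a+m}`. [folklore] -/
theorem RemovableAt.eq_of_tailStep_out {u : Site 2} {a m : Fin 6} (h : RemovableAt G u a m) (hD : IsTriDisc G b)
    {n₀ : ℕ} (hrun : ∀ s : ℕ, ∀ hs : s < m.val, triBdryIter G b (n₀ + s) = RemovableAt.blk u a ⟨s, by have := m.isLt; omega⟩)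
    (hdp : triBdryIter G b (n₀ + m.val) = RemovableAt.dPlus u a m)
    {n : ℕ} (hne : bdryTail G b n ≠ bdryTail G b (n + 1)) (hu : bdryTail G b n = u) :
    n % #(triBdryDarts G) = (n₀ + (m.val - 1)) % #(triBdryDarts G) ∧ bdryTail G b (n + 1) = u + triDir (a + m) := by
  set N := #(triBdryDarts G) with hN
  obtain ⟨s, hs, hmod⟩ := h.exists_eq_of_fst_iter_eq hD hrun hu
  -- `s = m - 1`: otherwise position `n + 1` is in the run too
  have hsm : s = m.val - 1 := by
    by_contra hsm
    have hnext : (n + 1) % N = (n₀ + (s + 1)) % N := by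
      rw [← add_assoc, Nat.add_mod, hmod, ← Nat.add_mod]
    have h1 : bdryTail G b (n + 1) = u := by
      rw [← bdryTail_mod hD, hnext, bdryTail_mod hD, bdryTail, hrun (s + 1) (by omega)]; rfl
    exact hne (hu.trans h1.symm)
  subst hsm
  refine ⟨hmod, ?_⟩
  have hnext : (n + 1) % N = (n₀ + m.val) % N := by
    rw [Nat.add_mod, hmod, ← Nat.add_mod]; congr 1; have := h.one_le; omega
  rw [← bdryTail_mod hD, hnext, bdryTail_mod hD, bdryTail, hdp, RemovableAt.dPlus]

/-- **No boundary edge is traversed twice.** If the unordered pairs of consecutive *distinct* tails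
at the steps `n` and `n'` agree, and all four tails involved are removable with outside blocks of
size `≤ 4`, then `n ≡ n'` modulo the period. (Same orientation: both steps leave the run of the
common old tail. Opposite orientations: the second tail would be entered from and left towards the
same neighbour, forcing an outside block of size `5`.) [folklore] -/
theorem tailStep_pair_eq (hD : IsTriDisc G b)
    (hrem : ∀ u ∈ G, (∃ j : Fin 6, u + triDir j ∉ G) → ∃ a m : Fin 6, RemovableAt G u a m ∧ m.val ≤ 4)
    {n n' : ℕ} (hne : bdryTail G b n ≠ bdryTail G b (n + 1)) (hne' : bdryTail G b n' ≠ bdryTail G b (n' + 1))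
    (hpair : s(bdryTail G b n, bdryTail G b (n + 1)) = s(bdryTail G b n', bdryTail G b (n' + 1))) :
    n % #(triBdryDarts G) = n' % #(triBdryDarts G) := by
  -- every tail is a boundary site, hence removable
  have hbd : ∀ k, ∃ a m : Fin 6, RemovableAt G (bdryTail G b k) a m ∧ m.val ≤ 4 := by
    intro k
    obtain ⟨hx, hy, hadj⟩ := mem_triBdryDarts.1 (triBdryIter_mem hD.base_mem k)
    obtain ⟨j, hj⟩ := (triGraph_adj_iff_triDir _ _).1 hadj
    exact hrem _ hx ⟨j, hj ▸ hy⟩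
  rcases Sym2.eq_iff.1 hpair with ⟨h1, h2⟩ | ⟨h1, h2⟩
  · -- same orientation: both steps leave the run of the old tail
    obtain ⟨a, m, hR, -⟩ := hbd n
    obtain ⟨n₀, -, hrun, hdp, -⟩ := hR.exists_run hD
    have e1 := (hR.eq_of_tailStep_out hD hrun hdp hne rfl).1
    have e2 := (hR.eq_of_tailStep_out hD hrun hdp hne' h1.symm).1
    rw [e1, e2]
  · -- opposite orientations: `y := tail (n+1) = tail n'` is entered from `x := tail n` and left towards `x`
    exfalso
    obtain ⟨a, m, hR, hm4⟩ := hbd (n + 1)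
    obtain ⟨n₀, -, hrun, hdp, hdm⟩ := hR.exists_run hD
    have hin := (hR.eq_of_tailStep_in hD hrun hdm hne rfl).2
    have hout := (hR.eq_of_tailStep_out hD hrun hdp hne' h2.symm).2
    -- `x = y + e_{a+5}` and `x = y + e_{a+m}`
    rw [← h1, hin] at hout
    have h5 : a + 5 = a + m := triDir_injective (add_left_cancel hout)
    have : (5 : Fin 6) = m := add_left_cancel h5
    have : m.val = 5 := by rw [← this]; rfl
    omega

end TailSteps

/-! ### The boundary edges at a site -/

section Edges

variable {G : Finset (Site 2)} {b : Site 2 × Site 2}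

/-- **The two boundary edges at a removable site.** A tail step ending at the removable site `u`
comes from `u + e_{a+5}`; a tail step starting at `u` goes to `u + e_{a+m}`; both are inside
neighbours of `u`, and they are distinct when `m ≤ 4`. [folklore] -/
theorem RemovableAt.tailStep_neighbours {u : Site 2} {a m : Fin 6} (h : RemovableAt G u a m) (hD : IsTriDisc G b) :
    (∀ n, bdryTail G b n ≠ bdryTail G b (n + 1) → bdryTail G b (n + 1) = u → bdryTail G b n = u + triDir (a + 5)) ∧
    (∀ n, bdryTail G b n ≠ bdryTail G b (n + 1) → bdryTail G b n = u → bdryTail G b (n + 1) = u + triDir (a + m)) ∧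
    u + triDir (a + 5) ∈ G ∧ u + triDir (a + m) ∈ G ∧ (m.val ≤ 4 → u + triDir (a + 5) ≠ u + triDir (a + m)) := by
  obtain ⟨n₀, -, hrun, hdp, hdm⟩ := h.exists_run hD
  refine ⟨fun n hne hu => (h.eq_of_tailStep_in hD hrun hdm hne hu).2,
    fun n hne hu => (h.eq_of_tailStep_out hD hrun hdp hne hu).2,
    h.inside (t := 5) h.le_five, h.inside (t := m) le_rfl, fun hm4 heq => ?_⟩
  have h5 : a + 5 = a + m := triDir_injective (add_left_cancel heq)
  have : (5 : Fin 6) = m := add_left_cancel h5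
  have : m.val = 5 := by rw [← this]; rfl
  omega

end Edges

end Literature.Probability.Percolation

end
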